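import Literature.MathematicalPhysics.QuantumFieldTheory.Balaban1983to89.B9Cor36GpCubeLocLetter
import Literature.MathematicalPhysics.QuantumFieldTheory.Balaban1983to89.B9CubeLettersBondOpsL0
import Literature.MathematicalPhysics.QuantumFieldTheory.Balaban1983to89.B9Thm311DeltaPrimeSymm

/-!
# `Balaban1983to89.B9Cor36CinvCubeLocLetter` — THE C-JUNCTION LETTER `C_□` OF [B9] (3.95) BUILT FROM THE RECORD's CUBE-SEQUENCE INVERSE
# `(Q′_□G′_□²Q′_□*)⁻¹(Ṽ)` (RULING #5), AND THE EXACT LOCAL-INVERSE IDENTITY `h_□·χ̃_□(Q′O_□O_□Q′*)(U)·C_□·h_□ = h_□² + E_□` WITH THE DEFECT `E_□`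
# IN CLOSED FORM — the per-cube displayed inputs `Cl`, `E`, `hdef` of p21's M5.6 defect edition `B9Thm39CinvAtCoverLargeDefect.cinv_cover_large_defect`
# (sub-row G-B9-LETTERS, module M5.2-E, FILE E2-1; design (β) of `lit-balaban-p21/M52E-DESIGN-p21.md`, GAPS.md G-B9-p21-01)

T. Bałaban, *Propagators for lattice gauge theories in a background field*, Commun. Math. Phys. **99** (1985) 389–434
[`Balaban1985BackgroundPropagators`, "B9"]; [4] = T. Bałaban, *Propagators and renormalization transformations for lattice gauge
theories. II*, Commun. Math. Phys. **96** (1984) 223–250 [`Balaban1984PropagatorsII`].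

statement-level skeleton of published theorems with citation tags; proofs where landed; nothing here is a claim about the
Yang–Mills mass gap

THE PRINTED LOCUS (verbatim, held `paper:balaban1985-cmp99-background-propagators`, journal page = PDF page + 388; page owner r06 g67, HOME∕INBOX
2026-08-28T11:27:36Z).  (3.95) p. 411 l. 5–10: *«Next let us consider the operator (Q′G′²Q′\*)⁻¹. We will find an expansion of this operator as usual considering
Q′G′²Q′\*C₀. We write it in the same way as in (2.82) [4] Q′G′²Q′\*C₀ = I + Σ_□(1 − □̃)Q′G′²Q′\*h_□C_□h_□ + Σ_□ □̃Q′(G′² − G′²_□)Q′\*h_□C_□h_□ + Σ_□[□̃Q′G′²_□Q′\*,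
h_□]C_□h_□ = I − R»*, which uses `h_□·□̃Q′G′²_□Q′\*·C_□h_□ = h_□²`; p. 409 l. 2–5: *«The operators constructed for this sequence, which we denote by G′_□(U),
C_□(U) = (Q′(U)G′²_□(U)Q′\*(U))⁻¹, … satisfy all the inequalities of Theorems 3.1–3.3 correspondingly»* (Q′ UNSUBSCRIPTED, G′_□ subscripted); [4] (2.79)–(2.82)
p. 237 (print's `C_□` is the inverse of the COMPRESSION of `Q′G′²_□Q′\*` by the global `Q′`, for which the identity above is exact); Cor. 3.6 p. 408 l. 11–14
(*«all the results of these theorems are gauge invariant, so they hold for the configuration U also»*); (3.28)–(3.33) pp. 395–396 (gauge covariance of `Q′(U)`,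
`Q′\*(U)`); (3.21) p. 394 (the block averaging `Q′(U)` transports a site to the corner of its block).

WHY THIS FILE (cell `lit-balaban`; module M5.2-E «the C-junction of M5.6» allocated → p21 g34 by the map owner r06 g67, `lit-balaban-r06/B9-LETTERS-MAP.md` §8
385c1abf3ea10dcc; design of record (β) confirmed 11:27:36Z; C-junction letter = p33's CUT letter per r05 g83 11:22:52Z (2)).  p21's M5.6 defect edition takes, per cover
cube `□`, a site letter `Oc □` (here: p33's `B9Cor36GpCubeLocLetter.locLetterY` = `M_χ∘R(u)⁻¹∘G′_□(Ṽ)∘R(u)∘M_χ`), a block operator `Cl □` and a DEFECT `E □` with the displayed law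
`hdef : M_h·(M_χ̃·(Q′(U)·O_□·O_□·Q′\*(U)))·Cl □·M_h = M_h·M_h + E □` (read first-hand, `B9Thm39CinvAtCoverLargeDefect` :129–:133), a (3.48) majorant `hC` of `Cl □` and the
defect majorant `hEd` of `E □`.  RULING #5 (lead g30, 2026-08-27) fixed the cell's `C_□` as the inverse over the CUBE SEQUENCE's OWN block lattice,
r05's `B9CubeLettersBondOpsL0.XinvCubeY i □ parS` on `BlkCubeY i □`; the member's law lives on `BlkY i`.  THIS FILE builds the bridge and the letter and
proves the law with its defect IN CLOSED FORM, from pointwise data only: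
* §1 THE BLOCK BRIDGE.  `cubeToBlkY` (`J`: extend a function on the cube sequence's blocks by zero to the member's blocks along the common
  `(level, label)` pairs) and `blkToCubeY` (`J⋆`); on a common pair the member's and the cube sequence's block DATA coincide — same sites
  (`blkOf_eq_iff_of_val_eq`), same corner (`blkCornerY_eq_of_val_eq`), same pairing weight, same rows of `Q′♯`, `Q′\*♯` (`qpK_eq_qpKc`, `qpsK_eq_qpsKc`) and
  the same averaging transporters at one field (`qpT_eq_qpTc`) — whence `R_b(u)∘J = J∘R_c(u)` (`conjY_comp_cubeToBlkY`) for def-Y's block gauge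
  `gBlkY` and its cube twin `gBlkCubeY`.
* §2 THE ROW IDENTITIES at the localised field: ★ `cutMulY_QpY_cutMulY_eq` (`M_h·Q′(U′)·M_χ = M_h·J·Q′_□(Ṽ)`) and ★ `cutMulY_QpsY_cubeToBlkY_eq`
  (`M_χ·Q′\*(U′)·J·1_N = Q′_□\*(Ṽ)·1_N`) from: `N` ⊂ common cube blocks, `supp h ⊂ J(N)`, `χ = 1` on the sites of the `N`-blocks, and agreement of the
  averaging transporters `parS U′ (corner s) z = parS Ṽ (corner s) z` on the `N`-blocks (`U′ = U^u`).
* §3 THE LETTER `cinvLocLetterY := J∘1_N∘R_c(u)⁻¹∘(Q′_□G′_□²Q′_□\*)⁻¹(Ṽ)∘R_c(u)∘1_N∘J⋆`, the defect `cinvLocDefectY := −R_b(u)⁻¹∘M_h∘J∘[X̂(Ṽ)∘(1 − 1_N) +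
  Q′_□G′_□∘(1 − M_χ²)∘G′_□Q′_□\*(Ṽ)∘1_N]∘Ĉ(Ṽ)∘R_c(u)∘1_N∘J⋆∘M_h` (a TRUNCATION part and an INNER-`(1 − χ²)` part, both supported off the plateau) and ★★
  `cutMulY_XY_locLetterY_cinvLocLetterY` — THE EXACT IDENTITY `M_h∘M_χ̃∘(Q′O_□O_□Q′\*)(U)∘Cl∘M_h = M_h∘M_h + E` — from (3.32) covariance of `Q′`, `Q′\*` (def-Y
  `Node00.QpY_cov`∕`QpsY_cov`), `R(u)M_χ = M_χR(u)` (p38 `intw_cutMulY`), §2, and `X̂(Ṽ)Ĉ(Ṽ) = 1` (r05, under `IsUnit`); ★★ `hdef_cinvLocLetterY` restates it over `ℝ`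
  in the EXACT SHAPE of M5.6's binder `hdef`.
* §4 ★ `parS_agree_of_agreeNearY`: the transporter agreement of §2–§3 from def-Y's `Node00.OpsYLocalInverseAgree.AgreeNearY` on a site set meeting every block of
  `N`, at a local transporter letter (`ParLocalY`) — the form in which p33's `B9Cor36CubeCutoffs.agreeNearY_DthY_locCfgY` delivers it.

HONEST SCOPE.  Finite-dimensional operator algebra over def-Y's and r05's DEFINED operators; NO estimate of [B9] is proved or used (the (3.48) majorant `hC` of the
letter and the defect majorant `hEd` are FILES E2-2∕E2-3 of the module; Sect. B's C-clause at the cube is FILE E2-4).  (R)-DESIGN TERM, NOT IN PRINT (GAPS.md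
G-B9-p21-01, countersigned r06 g67 l. 3115): print's `C_□` is [4] (2.79)–(2.82)'s compression inverse built with the GLOBAL `Q′`, for which `h_□X_□C_□h_□ = h_□²`
is exact and (3.95) has three sums; the record's `C_□` (RULING #5) is the inverse over the cube sequence's own block lattice, whose blocks differ from the
member's off r05's `NearH`, so the law holds with a defect `E_□` (fourth sum of p21's `B9Thm39CinvDefect.eq395_sum_defect`), displayed here in closed form and
majorised in FILE E2-3 by `e^{−O(δ₀M)}` factors ([4] p. 237: «partial estimates»).  The letter is a function of the CHOSEN gauge `u`, localised field `Ṽ`, cut-off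
`χ` and truncation set `N` — not gauge-covariant; `IsUnit (Q′_□G′_□²Q′_□\*)(Ṽ)`, `IsGaugeLawS`, commonness of `N`, the support∕plateau conditions and the transporter
agreement are HYPOTHESES here (inhabited: at `u := 1`, `Ṽ := U`, `χ := 1`, `N :=` the cube blocks meeting `supp h` near `□` they reduce to r05's
`B9CubeCoarsening.coarsen_blkOf_val_of_nearH` — not a vacuous schema; their discharge for the cut-offs of record is p33's `B9Cor36CubeCutoffs` pattern, FILE E2-3).
Count-neutral; no summit ∕ sub-problem statement is proved; nothing continuum ∕ OS ∕ mass-gap ∕ Clay.  No `sorry`, no `axiom`, no `… : Prop` fact, no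
`instance`, no `notation`.  NEW file; nothing landed is modified.  Cell `lit-balaban`, seat `lit-balaban-p21` gen 34, 2026-08-28; `--supports
stmt-QuantumFields-19200` as helper.  Net new unproved facts: 0.

RELATED IN THE TREE, NOT DUPLICATED (searched 2026-08-28): p33 `B9Cor36GpCubeLocLetter` (`locLetterY`, the G′-junction's EXACT laws — the member's `Δ′_a` rows near
`□` ARE the cube sequence's, so no defect there), `B9Cor36CubeCutoffs` (cut-offs∕plateaux of record); r05 `B9CubeLettersBondOpsL0` (`BlkCubeY`, `QpCubeY`,
`QpsCubeY`, `XCubeY`, `XinvCubeY`, `XCubeY_mul_XinvCubeY`), `B9CubeCoarsening` (nesting of the two block structures), `B9CubeLettersCovarianceL0` (covariance of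
the cube letters — not needed here: only the member's `Q′`, `Q′\*` are transported); def-Y `Node00.OpsYGauge` (`conjY`, `gSiteY`, `gBlkY`, `QpY_cov`, `QpsY_cov`,
`IsGaugeLawS`), `Node00.OpsYDeltaA` (`XY`, `QpY`, `QpsY`, `qpK`, `qpsK`, `qpT`, `trLiftY`); p38 `B9Thm37CubeCoverCommutators` (`cutMulY`, `intw_cutMulY`); n06-j `B9Thm311DeltaPrimeSymm` (`avgCoeffY_eq_ite`, `cornerY_levY_eq`); p21
`B9Thm39CinvDefect` … `B9Thm39CinvAtCoverMemberDefect` (the consumers) — USED BY NAME; no existing module modified.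
-/

noncomputable section

namespace Literature.MathematicalPhysics.QuantumFieldTheory.Balaban1983to89.B9Cor36CinvCubeLocLetter

open Literature.MathematicalPhysics.QuantumFieldTheory.Balaban1983to89.B9Eq39Adjoint (R R_zero)
open Literature.MathematicalPhysics.QuantumFieldTheory.Balaban1983to89.B6KLevelCensusIndexV1 (KIdx)
open Literature.MathematicalPhysics.QuantumFieldTheory.Balaban1983to89.B6Cover236MultiLevelBlocks (cubes)
open Literature.MathematicalPhysics.QuantumFieldTheory.Balaban1983to89.B6Geom246MultiLevelBox (bset blkOf blkOf_eq_iff_blk)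
open Literature.MathematicalPhysics.QuantumFieldTheory.Balaban1983to89.B6Ineq268MultiLevelBox (W W_eq)
open Literature.MathematicalPhysics.QuantumFieldTheory.Balaban1983to89.B9CubeLettersOpsL0 (cubeFamY GpCubeY)
open Literature.MathematicalPhysics.QuantumFieldTheory.Balaban1983to89.B9CubeLettersBondOpsL0 (BlkCubeY qpKc qpsKc blkCornerCubeY qpTc QpCubeY QpsCubeY
  XCubeY XinvCubeY XCubeY_mul_XinvCubeY)
open Literature.MathematicalPhysics.QuantumFieldTheory.Balaban1983to89.B9Cor36GpCubeLocLetter (locLetterY locLetterY_def)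
open Literature.MathematicalPhysics.QuantumFieldTheory.Balaban1983to89.B9Thm37CubeCoverCommutators (cutMulY cutMulY_apply cutMulY_mul cutMulY_sub cutMulY_one
  intw_cutMulY)
open Literature.MathematicalPhysics.QuantumFieldTheory.Balaban1983to89.Node00 (SiteY BlkY CfgY SiteParY GaugeY XY QpY QpsY qpK qpsK qpT blkCornerY trLiftY
  trLiftY_apply conjY conjY_apply conjY_mul conjY_one gSiteY gBlkY gaugeY IsGaugeLawS Intw QpY_cov QpsY_cov toKT levY cornerY avgCoeffY)
open Literature.MathematicalPhysics.QuantumFieldTheory.Balaban1983to89.Node00.OpsYLocalInverseAgree (AgreeNearY ParLocalY)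
open Literature.MathematicalPhysics.QuantumFieldTheory.Balaban1983to89.B6MultiLevelBoxOperator (levC_pos aPrinted)
open Literature.MathematicalPhysics.QuantumFieldTheory.Balaban1983to89.B6Prop23KLevelTorusCensus (aPrinted_pos)
open Literature.MathematicalPhysics.QuantumFieldTheory.Balaban1983to89.B9Thm311DeltaPrimeSymm (avgCoeffY_eq_ite cornerY_levY_eq)

variable {d ℓ : ℕ} {hd : 1 ≤ d + 1} {hL : Odd (ℓ + 1) ∧ 1 < ℓ + 1} {b₀ b₁ : ℝ}
variable {𝔸 : Type} [NormedRing 𝔸] [NormedAlgebra ℂ 𝔸] [CompleteSpace 𝔸]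

/-! ## §1 The block bridge between the cube sequence's blocks and the member's blocks -/

section Bridge

variable (i : KIdx d ℓ hd hL b₀ b₁) (q : ↥(cubes (toKT i).D.toDomains))

/-- **`J`: EXTENSION BY ZERO FROM THE CUBE SEQUENCE's BLOCKS TO THE MEMBER's BLOCKS** along the common `(level, label)` pairs (near `□` the two block
structures coincide, r05 `B9CubeCoarsening.coarsen_blkOf_val_of_nearH`; off `□` a member block is in general not a block of `{Ω_n(□)}` and receives `0`).
[cite: Balaban1985BackgroundPropagators, p.408 l.36–44, (3.87) p.409; Balaban1984PropagatorsII, (2.45) p.231, dictionary] -/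
def cubeToBlkY : (BlkCubeY i q → 𝔸) →ₗ[ℂ] (BlkY i → 𝔸) where
  toFun μ := fun t => if ht : t.1 ∈ B6Geom246MultiLevelBoxL0.bset (cubeFamY i q).toDomains then μ ⟨t.1, ht⟩ else 0
  map_add' μ μ' := by
    funext t
    simp only [Pi.add_apply]
    split_ifs <;> simp
  map_smul' c μ := by
    funext t
    simp only [Pi.smul_apply, RingHom.id_apply]
    split_ifs <;> simp

/-- **`J⋆`: RESTRICTION∕EXTENSION BY ZERO FROM THE MEMBER's BLOCKS TO THE CUBE SEQUENCE's BLOCKS** along the common pairs.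
[cite: Balaban1985BackgroundPropagators, p.408 l.36–44, (3.87) p.409; Balaban1984PropagatorsII, (2.45) p.231, dictionary] -/
def blkToCubeY : (BlkY i → 𝔸) →ₗ[ℂ] (BlkCubeY i q → 𝔸) where
  toFun ν := fun s => if hs : s.1 ∈ bset i.D.toDomains then ν ⟨s.1, hs⟩ else 0
  map_add' ν ν' := by
    funext s
    simp only [Pi.add_apply]
    split_ifs <;> simp
  map_smul' c ν := by
    funext s
    simp only [Pi.smul_apply, RingHom.id_apply]
    split_ifs <;> simp

omit [CompleteSpace 𝔸] in
/-- `J`, evaluated on a common pair. [cite: Balaban1984PropagatorsII, (2.45) p.231, bookkeeping] -/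
theorem cubeToBlkY_apply_of_mem (μ : BlkCubeY i q → 𝔸) {t : BlkY i} (ht : t.1 ∈ B6Geom246MultiLevelBoxL0.bset (cubeFamY i q).toDomains) :
    cubeToBlkY i q μ t = μ ⟨t.1, ht⟩ := by
  show (if ht : t.1 ∈ B6Geom246MultiLevelBoxL0.bset (cubeFamY i q).toDomains then μ ⟨t.1, ht⟩ else 0) = _
  rw [dif_pos ht]

omit [CompleteSpace 𝔸] in
/-- `J`, evaluated off the common pairs. [cite: Balaban1984PropagatorsII, (2.45) p.231, bookkeeping] -/
theorem cubeToBlkY_apply_of_not_mem (μ : BlkCubeY i q → 𝔸) {t : BlkY i} (ht : t.1 ∉ B6Geom246MultiLevelBoxL0.bset (cubeFamY i q).toDomains) :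
    cubeToBlkY i q μ t = 0 := by
  show (if ht : t.1 ∈ B6Geom246MultiLevelBoxL0.bset (cubeFamY i q).toDomains then μ ⟨t.1, ht⟩ else 0) = _
  rw [dif_neg ht]

omit [CompleteSpace 𝔸] in
/-- `J⋆`, evaluated on a common pair. [cite: Balaban1984PropagatorsII, (2.45) p.231, bookkeeping] -/
theorem blkToCubeY_apply_of_mem (ν : BlkY i → 𝔸) {s : BlkCubeY i q} (hs : s.1 ∈ bset i.D.toDomains) :
    blkToCubeY i q ν s = ν ⟨s.1, hs⟩ := by
  show (if hs : s.1 ∈ bset i.D.toDomains then ν ⟨s.1, hs⟩ else 0) = _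
  rw [dif_pos hs]

omit [CompleteSpace 𝔸] in
/-- `J⋆`, evaluated off the common pairs. [cite: Balaban1984PropagatorsII, (2.45) p.231, bookkeeping] -/
theorem blkToCubeY_apply_of_not_mem (ν : BlkY i → 𝔸) {s : BlkCubeY i q} (hs : s.1 ∉ bset i.D.toDomains) :
    blkToCubeY i q ν s = 0 := by
  show (if hs : s.1 ∈ bset i.D.toDomains then ν ⟨s.1, hs⟩ else 0) = _
  rw [dif_neg hs]

omit [NormedRing 𝔸] [NormedAlgebra ℂ 𝔸] [CompleteSpace 𝔸] in
/-- **ON A COMMON PAIR THE TWO BLOCKS HAVE THE SAME SITES**: a site lies in the member block `(j, y)` iff it lies in the cube sequence's block `(j, y)` (both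
are «the level-`j` label of the site is `y`»; territories are unions of blocks of their own level). [cite: Balaban1984PropagatorsII, (2.1) p.224, (2.45) p.231] -/
theorem blkOf_eq_iff_of_val_eq {t : BlkY i} {s : BlkCubeY i q} (hts : t.1 = s.1) (z : SiteY i) :
    blkOf i.D.toDomains z = t ↔ B6Geom246MultiLevelBoxL0.blkOf (cubeFamY i q).toDomains z = s := by
  rw [blkOf_eq_iff_blk, B6Geom246MultiLevelBoxL0.blkOf_eq_iff_blk, hts]

omit [NormedRing 𝔸] [NormedAlgebra ℂ 𝔸] [CompleteSpace 𝔸] in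
/-- a member block whose pair is a pair of the cube sequence: the cube block of each of its sites is that pair. [cite: Balaban1984PropagatorsII, (2.45) p.231, bookkeeping] -/
theorem cube_blkOf_val_eq_of_mem {z : SiteY i} (h : (blkOf i.D.toDomains z).1 ∈ B6Geom246MultiLevelBoxL0.bset (cubeFamY i q).toDomains) :
    (B6Geom246MultiLevelBoxL0.blkOf (cubeFamY i q).toDomains z).1 = (blkOf i.D.toDomains z).1 :=
  congrArg Subtype.val ((blkOf_eq_iff_of_val_eq i q (t := blkOf i.D.toDomains z) (s := ⟨_, h⟩) rfl z).1 rfl)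

omit [NormedRing 𝔸] [NormedAlgebra ℂ 𝔸] [CompleteSpace 𝔸] in
/-- a cube block whose pair is a pair of the member: the member block of each of its sites is that pair. [cite: Balaban1984PropagatorsII, (2.45) p.231, bookkeeping] -/
theorem blkOf_val_eq_of_mem {z : SiteY i} (h : (B6Geom246MultiLevelBoxL0.blkOf (cubeFamY i q).toDomains z).1 ∈ bset i.D.toDomains) :
    (blkOf i.D.toDomains z).1 = (B6Geom246MultiLevelBoxL0.blkOf (cubeFamY i q).toDomains z).1 :=
  congrArg Subtype.val ((blkOf_eq_iff_of_val_eq i q (t := ⟨_, h⟩) (s := B6Geom246MultiLevelBoxL0.blkOf (cubeFamY i q).toDomains z) rfl z).2 rfl)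

omit [NormedRing 𝔸] [NormedAlgebra ℂ 𝔸] [CompleteSpace 𝔸] in
/-- on a common pair the (2.69) pairing weights `(L^jη)^{d+1}` agree. [cite: Balaban1984PropagatorsII, (2.69) p.235, bookkeeping] -/
theorem W_eq_of_val_eq {t : BlkY i} {s : BlkCubeY i q} (hts : t.1 = s.1) :
    W i.D.toDomains t = B6Ineq268MultiLevelBoxL0.W (cubeFamY i q).toDomains s := by
  rw [W_eq, B6Ineq268MultiLevelBoxL0.W_eq, hts]

omit [NormedRing 𝔸] [NormedAlgebra ℂ 𝔸] [CompleteSpace 𝔸] in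
/-- **ON A COMMON PAIR THE ROWS OF `Q′♯` AGREE**: `q′(t, z) = q′_□(s, z)`. [cite: Balaban1985BackgroundPropagators, (3.19) p.393, (3.21) p.394; Balaban1984PropagatorsII, (2.14) p.225] -/
theorem qpK_eq_qpKc {t : BlkY i} {s : BlkCubeY i q} (hts : t.1 = s.1) (z : SiteY i) : qpK i t z = qpKc i q s z := by
  show (if blkOf i.D.toDomains z = t then (W i.D.toDomains t)⁻¹ else 0) =
    (if B6Geom246MultiLevelBoxL0.blkOf (cubeFamY i q).toDomains z = s then (B6Ineq268MultiLevelBoxL0.W (cubeFamY i q).toDomains s)⁻¹ else 0)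
  by_cases hz : B6Geom246MultiLevelBoxL0.blkOf (cubeFamY i q).toDomains z = s
  · rw [if_pos hz, if_pos ((blkOf_eq_iff_of_val_eq i q hts z).2 hz), W_eq_of_val_eq i q hts]
  · rw [if_neg hz, if_neg (mt (blkOf_eq_iff_of_val_eq i q hts z).1 hz)]

omit [NormedRing 𝔸] [NormedAlgebra ℂ 𝔸] [CompleteSpace 𝔸] in
/-- **ON A COMMON PAIR THE COLUMNS OF `Q′*♯` AGREE**: `q′*(z, t) = q′*_□(z, s)`. [cite: Balaban1985BackgroundPropagators, (3.21) p.394; Balaban1984PropagatorsII, (2.69) p.235] -/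
theorem qpsK_eq_qpsKc {t : BlkY i} {s : BlkCubeY i q} (hts : t.1 = s.1) (z : SiteY i) : qpsK i z t = qpsKc i q z s := by
  show (if blkOf i.D.toDomains z = t then (1 : ℝ) else 0) = (if B6Geom246MultiLevelBoxL0.blkOf (cubeFamY i q).toDomains z = s then (1 : ℝ) else 0)
  by_cases hz : B6Geom246MultiLevelBoxL0.blkOf (cubeFamY i q).toDomains z = s
  · rw [if_pos hz, if_pos ((blkOf_eq_iff_of_val_eq i q hts z).2 hz)]
  · rw [if_neg hz, if_neg (mt (blkOf_eq_iff_of_val_eq i q hts z).1 hz)]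

omit [NormedRing 𝔸] [NormedAlgebra ℂ 𝔸] [CompleteSpace 𝔸] in
/-- **ON A COMMON PAIR THE CORNERS AGREE** (`L^j·y` in both structures). [cite: Balaban1985BackgroundPropagators, (3.21) p.394; Balaban1984PropagatorsII, (2.1) p.224, dictionary] -/
theorem blkCornerY_eq_of_val_eq {t : BlkY i} {s : BlkCubeY i q} (hts : t.1 = s.1) : blkCornerY i t = blkCornerCubeY i q s := by
  apply Subtype.ext
  show B6Geom246MultiLevelBox.corner i.D.toDomains t = B6Geom246MultiLevelBoxL0.corner (cubeFamY i q).toDomains s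
  unfold B6Geom246MultiLevelBox.corner B6Geom246MultiLevelBoxL0.corner
  rw [hts]

/-- **ON A COMMON PAIR THE AVERAGING TRANSPORTERS OF `Q′(U)` AND `Q′_□(U)` AGREE** at one and the same field (both transport the site to the common corner along
`parS`). [cite: Balaban1985BackgroundPropagators, (3.21) p.394 («U(Γ_{y,x})»)] -/
theorem qpT_eq_qpTc (parS : SiteParY 𝔸 i) (U : CfgY 𝔸 i) {t : BlkY i} {s : BlkCubeY i q} (hts : t.1 = s.1) (z : SiteY i) :
    qpT i parS U t z = qpTc i q parS U s z := by
  show parS U (blkCornerY i t) z = parS U (blkCornerCubeY i q s) z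
  rw [blkCornerY_eq_of_val_eq i q hts]

/-- **ON A COMMON PAIR THE ROWS OF `Q′(V)` AND `Q′_□(V)` AGREE** (same kernel row, same transporters). [cite: Balaban1985BackgroundPropagators, (3.21) p.394, p.409 l.2–5] -/
theorem QpY_apply_eq_QpCubeY_apply (parS : SiteParY 𝔸 i) (V : CfgY 𝔸 i) {t : BlkY i} {s : BlkCubeY i q} (hts : t.1 = s.1) (Λ : SiteY i → 𝔸) :
    QpY i parS V Λ t = QpCubeY i q parS V Λ s := by
  show trLiftY (qpK i) (qpT i parS V) Λ t = trLiftY (qpKc i q) (qpTc i q parS V) Λ s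
  rw [trLiftY_apply, trLiftY_apply]
  refine Finset.sum_congr rfl fun z _ => ?_
  rw [qpK_eq_qpKc i q hts, qpT_eq_qpTc i q parS V hts]

/-- the cube twin `u(c_s)` of def-Y's block gauge `gBlkY` (`u` read at the corner of a block of the cube sequence).
[cite: Balaban1985BackgroundPropagators, (3.21) p.394, (3.28) p.395, dictionary] -/
def gBlkCubeY (g : GaugeY 𝔸 i) : BlkCubeY i q → 𝔸ˣ := fun s => gSiteY i g (blkCornerCubeY i q s)

omit [CompleteSpace 𝔸] in
/-- **`R_b(γ)∘J = J∘R_c(γ)`** for a gauge function read at the block corners (the corners of a common pair agree).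
[cite: Balaban1985BackgroundPropagators, (3.28) p.395, (3.21) p.394, bookkeeping] -/
theorem conjY_comp_cubeToBlkY (γ : SiteY i → 𝔸ˣ) :
    conjY (fun t => γ (blkCornerY i t)) ∘ₗ cubeToBlkY i q = cubeToBlkY i q ∘ₗ conjY (fun s => γ (blkCornerCubeY i q s)) := by
  refine LinearMap.ext fun μ => funext fun t => ?_
  rw [LinearMap.comp_apply, LinearMap.comp_apply, conjY_apply]
  by_cases ht : t.1 ∈ B6Geom246MultiLevelBoxL0.bset (cubeFamY i q).toDomains
  · rw [cubeToBlkY_apply_of_mem i q _ ht, cubeToBlkY_apply_of_mem i q _ ht, conjY_apply,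
      blkCornerY_eq_of_val_eq i q (t := t) (s := ⟨t.1, ht⟩) rfl]
  · rw [cubeToBlkY_apply_of_not_mem i q _ ht, cubeToBlkY_apply_of_not_mem i q _ ht, R_zero]

omit [CompleteSpace 𝔸] in
/-- **`J⋆∘R_b(γ) = R_c(γ)∘J⋆`**. [cite: Balaban1985BackgroundPropagators, (3.28) p.395, (3.21) p.394, bookkeeping] -/
theorem blkToCubeY_comp_conjY (γ : SiteY i → 𝔸ˣ) :
    blkToCubeY i q ∘ₗ conjY (fun t => γ (blkCornerY i t)) = conjY (fun s => γ (blkCornerCubeY i q s)) ∘ₗ blkToCubeY i q := by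
  refine LinearMap.ext fun ν => funext fun s => ?_
  rw [LinearMap.comp_apply, LinearMap.comp_apply, conjY_apply]
  by_cases hs : s.1 ∈ bset i.D.toDomains
  · rw [blkToCubeY_apply_of_mem i q _ hs, blkToCubeY_apply_of_mem i q _ hs, conjY_apply,
      blkCornerY_eq_of_val_eq i q (t := ⟨s.1, hs⟩) (s := s) rfl]
  · rw [blkToCubeY_apply_of_not_mem i q _ hs, blkToCubeY_apply_of_not_mem i q _ hs, R_zero]

/-- `R_b(u)∘J = J∘R_c(u)` for def-Y's block gauge. [cite: Balaban1985BackgroundPropagators, (3.28) p.395, bookkeeping] -/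
theorem conjY_gBlkY_cubeToBlkY (g : GaugeY 𝔸 i) (μ : BlkCubeY i q → 𝔸) :
    conjY (gBlkY i g) (cubeToBlkY i q μ) = cubeToBlkY i q (conjY (gBlkCubeY i q g) μ) :=
  LinearMap.congr_fun (conjY_comp_cubeToBlkY i q (gSiteY i g)) μ

/-- `R_b(u)⁻¹∘J = J∘R_c(u)⁻¹`. [cite: Balaban1985BackgroundPropagators, (3.28) p.395, (3.31) p.395, bookkeeping] -/
theorem conjY_gBlkY_inv_cubeToBlkY (g : GaugeY 𝔸 i) (μ : BlkCubeY i q → 𝔸) :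
    conjY (gBlkY i g)⁻¹ (cubeToBlkY i q μ) = cubeToBlkY i q (conjY (gBlkCubeY i q g)⁻¹ μ) :=
  LinearMap.congr_fun (conjY_comp_cubeToBlkY i q (gSiteY i g)⁻¹) μ

/-- `J⋆∘R_b(u) = R_c(u)∘J⋆`. [cite: Balaban1985BackgroundPropagators, (3.28) p.395, bookkeeping] -/
theorem blkToCubeY_conjY_gBlkY (g : GaugeY 𝔸 i) (ν : BlkY i → 𝔸) :
    blkToCubeY i q (conjY (gBlkY i g) ν) = conjY (gBlkCubeY i q g) (blkToCubeY i q ν) :=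
  LinearMap.congr_fun (blkToCubeY_comp_conjY i q (gSiteY i g)) ν

/-- the indicator of a set of blocks of the cube sequence (the truncation `1_N`). [cite: Balaban1984PropagatorsII, (2.79)–(2.82) p.237, dictionary] -/
def cubeBlkInd (N : Finset (BlkCubeY i q)) : BlkCubeY i q → ℝ := fun s => if s ∈ N then 1 else 0

omit [NormedRing 𝔸] [NormedAlgebra ℂ 𝔸] [CompleteSpace 𝔸] in
/-- the indicator, evaluated. [cite: Balaban1984PropagatorsII, (2.79) p.237, bookkeeping] -/
theorem cubeBlkInd_apply (N : Finset (BlkCubeY i q)) (s : BlkCubeY i q) : cubeBlkInd i q N s = if s ∈ N then 1 else 0 := rfl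

omit [CompleteSpace 𝔸] in
/-- **`M_h∘J∘1_N∘J⋆ = M_h`** when `supp h` consists of member twins of blocks of `N`. [cite: Balaban1984PropagatorsII, (2.79)–(2.82) p.237, bookkeeping] -/
theorem cutMulY_cubeToBlkY_ind_blkToCubeY (h : BlkY i → ℝ) (N : Finset (BlkCubeY i q)) (hh : ∀ t, h t ≠ 0 → ∃ s ∈ N, s.1 = t.1) (ν : BlkY i → 𝔸) :
    cutMulY h (cubeToBlkY i q (cutMulY (cubeBlkInd i q N) (blkToCubeY i q ν))) = cutMulY h ν := by
  funext t
  rw [cutMulY_apply, cutMulY_apply]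
  by_cases ht : h t = 0
  · rw [ht, Complex.ofReal_zero, zero_smul, zero_smul]
  obtain ⟨s, hsN, hst⟩ := hh t ht
  have ht' : t.1 ∈ B6Geom246MultiLevelBoxL0.bset (cubeFamY i q).toDomains := hst ▸ s.2
  have hs : (⟨t.1, ht'⟩ : BlkCubeY i q) = s := Subtype.ext hst.symm
  have hs' : s.1 ∈ bset i.D.toDomains := hst ▸ t.2
  have ht2 : (⟨s.1, hs'⟩ : BlkY i) = t := Subtype.ext hst
  rw [cubeToBlkY_apply_of_mem i q _ ht', hs, cutMulY_apply, cubeBlkInd_apply, if_pos hsN, Complex.ofReal_one, one_smul,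
    blkToCubeY_apply_of_mem i q _ hs', ht2]

end Bridge

/-! ## §2 The two row identities at the localised field -/

section Rows

variable (i : KIdx d ℓ hd hL b₀ b₁) (q : ↥(cubes (toKT i).D.toDomains)) (parS : SiteParY 𝔸 i)

/-- ★ **`M_h·Q′(U′)·M_χ = M_h·J·Q′_□(Ṽ)`**: on the rows of the member blocks carrying `h` — twins of blocks of `N` — the member's block averaging at `U′` cut off
by `χ` IS the cube sequence's block averaging at `Ṽ`, provided `χ = 1` on the sites of the `N`-blocks and the averaging transporters of `U′` and `Ṽ` agree there.
[cite: Balaban1985BackgroundPropagators, (3.21) p.394, p.409 l.2–5, Cor. 3.6 p.408 l.11–14, p.410 l.14–15] -/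
theorem cutMulY_QpY_cutMulY_eq (U' V : CfgY 𝔸 i) (χ : SiteY i → ℝ) (h : BlkY i → ℝ) (N : Finset (BlkCubeY i q))
    (hh : ∀ t, h t ≠ 0 → ∃ s ∈ N, s.1 = t.1)
    (hχ : ∀ z, B6Geom246MultiLevelBoxL0.blkOf (cubeFamY i q).toDomains z ∈ N → χ z = 1)
    (hagree : ∀ s ∈ N, ∀ z, B6Geom246MultiLevelBoxL0.blkOf (cubeFamY i q).toDomains z = s →
      parS U' (blkCornerCubeY i q s) z = parS V (blkCornerCubeY i q s) z)
    (Λ : SiteY i → 𝔸) :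
    cutMulY h (QpY i parS U' (cutMulY χ Λ)) = cutMulY h (cubeToBlkY i q (QpCubeY i q parS V Λ)) := by
  funext t
  rw [cutMulY_apply, cutMulY_apply]
  by_cases ht : h t = 0
  · rw [ht, Complex.ofReal_zero, zero_smul, zero_smul]
  obtain ⟨s, hsN, hst⟩ := hh t ht
  have ht' : t.1 ∈ B6Geom246MultiLevelBoxL0.bset (cubeFamY i q).toDomains := hst ▸ s.2
  have hs : (⟨t.1, ht'⟩ : BlkCubeY i q) = s := Subtype.ext hst.symm
  rw [cubeToBlkY_apply_of_mem i q _ ht', hs]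
  congr 1
  show trLiftY (qpK i) (qpT i parS U') (cutMulY χ Λ) t = trLiftY (qpKc i q) (qpTc i q parS V) Λ s
  rw [trLiftY_apply, trLiftY_apply]
  refine Finset.sum_congr rfl fun z _ => ?_
  rw [qpK_eq_qpKc i q hst.symm]
  by_cases hz : B6Geom246MultiLevelBoxL0.blkOf (cubeFamY i q).toDomains z = s
  · rw [qpT_eq_qpTc i q parS U' hst.symm, cutMulY_apply, hχ z (hz ▸ hsN), Complex.ofReal_one, one_smul]
    show _ • R (parS U' (blkCornerCubeY i q s) z) (Λ z) = _ • R (parS V (blkCornerCubeY i q s) z) (Λ z)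
    rw [hagree s hsN z hz]
  · have h0 : qpKc i q s z = 0 := by
      show (if B6Geom246MultiLevelBoxL0.blkOf (cubeFamY i q).toDomains z = s then
        (B6Ineq268MultiLevelBoxL0.W (cubeFamY i q).toDomains s)⁻¹ else 0) = 0
      rw [if_neg hz]
    rw [h0, Complex.ofReal_zero, zero_smul, zero_smul]

/-- ★ **`M_χ·Q′*(U′)·J·1_N = Q′_□*(Ṽ)·1_N`**: on block functions supported on `N` (common blocks) the member's `Q′*` at `U′` IS the cube sequence's `Q′*` at `Ṽ`, and
the cut-off `χ` is invisible (its plateau covers the `N`-blocks). [cite: Balaban1985BackgroundPropagators, (3.21) p.394, (3.24)–(3.25) p.394, p.409 l.2–5, p.410 l.14–15] -/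
theorem cutMulY_QpsY_cubeToBlkY_eq (U' V : CfgY 𝔸 i) (χ : SiteY i → ℝ) (N : Finset (BlkCubeY i q))
    (hN : ∀ s ∈ N, s.1 ∈ bset i.D.toDomains)
    (hχ : ∀ z, B6Geom246MultiLevelBoxL0.blkOf (cubeFamY i q).toDomains z ∈ N → χ z = 1)
    (hagree : ∀ s ∈ N, ∀ z, B6Geom246MultiLevelBoxL0.blkOf (cubeFamY i q).toDomains z = s →
      parS U' (blkCornerCubeY i q s) z = parS V (blkCornerCubeY i q s) z)
    (μ : BlkCubeY i q → 𝔸) :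
    cutMulY χ (QpsY i parS U' (cubeToBlkY i q (cutMulY (cubeBlkInd i q N) μ))) = QpsCubeY i q parS V (cutMulY (cubeBlkInd i q N) μ) := by
  funext z
  set t₀ := blkOf i.D.toDomains z with ht₀
  set s₀ := B6Geom246MultiLevelBoxL0.blkOf (cubeFamY i q).toDomains z with hs₀
  rw [cutMulY_apply]
  show _ • trLiftY (qpsK i) (fun z s => (qpT i parS U' s z)⁻¹) _ z = trLiftY (qpsKc i q) (fun z s => (qpTc i q parS V s z)⁻¹) _ z
  rw [trLiftY_apply, trLiftY_apply, Finset.sum_eq_single t₀, Finset.sum_eq_single s₀]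
  rotate_left
  · intro s _ hs
    have h0 : qpsKc i q z s = 0 := by
      show (if B6Geom246MultiLevelBoxL0.blkOf (cubeFamY i q).toDomains z = s then (1 : ℝ) else 0) = 0
      rw [if_neg (Ne.symm hs)]
    rw [h0, Complex.ofReal_zero, zero_smul]
  · exact fun h => absurd (Finset.mem_univ _) h
  · intro t _ ht
    have h0 : qpsK i z t = 0 := by
      show (if blkOf i.D.toDomains z = t then (1 : ℝ) else 0) = 0
      rw [if_neg (Ne.symm ht)]
    rw [h0, Complex.ofReal_zero, zero_smul]
  · exact fun h => absurd (Finset.mem_univ _) h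
  have h1 : qpsK i z t₀ = 1 := by
    show (if blkOf i.D.toDomains z = t₀ then (1 : ℝ) else 0) = 1
    rw [if_pos rfl]
  have h1c : qpsKc i q z s₀ = 1 := by
    show (if B6Geom246MultiLevelBoxL0.blkOf (cubeFamY i q).toDomains z = s₀ then (1 : ℝ) else 0) = 1
    rw [if_pos rfl]
  rw [h1, h1c, Complex.ofReal_one, one_smul, one_smul, cutMulY_apply, cubeBlkInd_apply]
  by_cases hs : s₀ ∈ N
  · -- a block of `N`: common, on the plateau, transporters agree
    have hts : t₀.1 = s₀.1 := blkOf_val_eq_of_mem i q (hN s₀ hs)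
    have ht' : t₀.1 ∈ B6Geom246MultiLevelBoxL0.bset (cubeFamY i q).toDomains := hts ▸ s₀.2
    have hs' : (⟨t₀.1, ht'⟩ : BlkCubeY i q) = s₀ := Subtype.ext hts
    rw [cubeToBlkY_apply_of_mem i q _ ht', hs', cutMulY_apply, cubeBlkInd_apply, if_pos hs, Complex.ofReal_one, one_smul,
      hχ z hs, Complex.ofReal_one, one_smul, qpT_eq_qpTc i q parS U' hts]
    show R (parS U' (blkCornerCubeY i q s₀) z)⁻¹ (μ s₀) = R (parS V (blkCornerCubeY i q s₀) z)⁻¹ (μ s₀)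
    rw [hagree s₀ hs z rfl]
  · -- off `N`: both sides vanish
    rw [if_neg hs, Complex.ofReal_zero, zero_smul, R_zero]
    by_cases ht' : t₀.1 ∈ B6Geom246MultiLevelBoxL0.bset (cubeFamY i q).toDomains
    · have hs' : (⟨t₀.1, ht'⟩ : BlkCubeY i q) = s₀ := Subtype.ext (cube_blkOf_val_eq_of_mem i q ht').symm
      rw [cubeToBlkY_apply_of_mem i q _ ht', hs', cutMulY_apply, cubeBlkInd_apply, if_neg hs, Complex.ofReal_zero, zero_smul, R_zero, smul_zero]
    · rw [cubeToBlkY_apply_of_not_mem i q _ ht', R_zero, smul_zero]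

end Rows

/-! ## §3 The C-junction letter, its defect in closed form, and the exact local-inverse identity -/

section Letter

variable (i : KIdx d ℓ hd hL b₀ b₁) (q : ↥(cubes (toKT i).D.toDomains)) (parS : SiteParY 𝔸 i)

/-- ★ **THE C-JUNCTION LETTER OF THE (R)-DESIGN**: `C_□ := J∘1_N∘R_c(u)⁻¹∘(Q′_□G′_□²Q′_□*)⁻¹(Ṽ)∘R_c(u)∘1_N∘J⋆` — the record's cube-sequence inverse (RULING #5) read at
the localised field `Ṽ`, transported back along the gauge `u`, truncated to a set `N` of common blocks and moved to the member's block carrier.  Print's `C_□(U)` (p. 409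
l. 4, [4] (2.79)–(2.82)) is the compression inverse built with the global `Q′` and needs none of these devices (GAPS.md G-B9-p21-01).
[cite: Balaban1985BackgroundPropagators, p.409 l.2–5, (3.95) p.411; Balaban1984PropagatorsII, (2.79)–(2.82) p.237] -/
def cinvLocLetterY (g : GaugeY 𝔸 i) (V : CfgY 𝔸 i) (N : Finset (BlkCubeY i q)) : Module.End ℂ (BlkY i → 𝔸) :=
  cubeToBlkY i q ∘ₗ cutMulY (cubeBlkInd i q N) ∘ₗ conjY (gBlkCubeY i q g)⁻¹ ∘ₗ XinvCubeY i q parS V ∘ₗ conjY (gBlkCubeY i q g) ∘ₗ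
    cutMulY (cubeBlkInd i q N) ∘ₗ blkToCubeY i q

/-- the CORE of the defect on the cube sequence's blocks: `[X̂(Ṽ)∘(1 − 1_N) + Q′_□G′_□(Ṽ)∘(1 − M_χ²)∘G′_□Q′_□*(Ṽ)∘1_N]∘Ĉ(Ṽ)` — a TRUNCATION part (the rows of
`X̂ = Q′_□G′_□²Q′_□*` from `N` to its complement) and an INNER-`(1 − χ²)` part (the cut-off between the two factors `G′_□`), both supported off the plateau.
[cite: Balaban1985BackgroundPropagators, (3.95) p.411, p.412 l.31–36; Balaban1984PropagatorsII, (2.79)–(2.85) pp.237–238] -/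
def cinvDefectCoreY (χ : SiteY i → ℝ) (V : CfgY 𝔸 i) (N : Finset (BlkCubeY i q)) : Module.End ℂ (BlkCubeY i q → 𝔸) :=
  (XCubeY i q parS V ∘ₗ cutMulY (fun s => 1 - cubeBlkInd i q N s) +
      QpCubeY i q parS V ∘ₗ GpCubeY i q parS V ∘ₗ cutMulY (fun z => 1 - χ z * χ z) ∘ₗ GpCubeY i q parS V ∘ₗ QpsCubeY i q parS V ∘ₗ
        cutMulY (cubeBlkInd i q N)) ∘ₗ
    XinvCubeY i q parS V

/-- ★ **THE DEFECT `E_□` IN CLOSED FORM**: `E_□ := −R_b(u)⁻¹∘M_h∘J∘(core)∘R_c(u)∘1_N∘J⋆∘M_h` — the (R)-DESIGN TERM of p21's fourth sum (`B9Thm39CinvDefect.eq395_sum_defect`),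
NOT IN PRINT (G-B9-p21-01). [cite: Balaban1985BackgroundPropagators, (3.95) p.411; Balaban1984PropagatorsII, (2.82)–(2.85) pp.237–238] -/
def cinvLocDefectY (g : GaugeY 𝔸 i) (χ : SiteY i → ℝ) (V : CfgY 𝔸 i) (N : Finset (BlkCubeY i q)) (h : BlkY i → ℝ) : Module.End ℂ (BlkY i → 𝔸) :=
  -(conjY (gBlkY i g)⁻¹ ∘ₗ cutMulY h ∘ₗ cubeToBlkY i q ∘ₗ cinvDefectCoreY i q parS χ V N ∘ₗ conjY (gBlkCubeY i q g) ∘ₗ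
      cutMulY (cubeBlkInd i q N) ∘ₗ blkToCubeY i q ∘ₗ cutMulY h)

omit [CompleteSpace 𝔸] in
/-- `R(γ⁻¹)R(γ) = 1` on any carrier, applied. [cite: Balaban1985BackgroundPropagators, (3.31) p.395, bookkeeping] -/
theorem conjY_inv_conjY_apply {X : Type} [Fintype X] (γ : X → 𝔸ˣ) (w : X → 𝔸) : conjY γ⁻¹ (conjY γ w) = w := by
  show (conjY γ⁻¹ ∘ₗ conjY γ) w = w
  rw [← conjY_mul, inv_mul_cancel, conjY_one, LinearMap.id_apply]

omit [CompleteSpace 𝔸] in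
/-- `R(γ)R(γ⁻¹) = 1` on any carrier, applied. [cite: Balaban1985BackgroundPropagators, (3.31) p.395, bookkeeping] -/
theorem conjY_conjY_inv_apply {X : Type} [Fintype X] (γ : X → 𝔸ˣ) (w : X → 𝔸) : conjY γ (conjY γ⁻¹ w) = w := by
  show (conjY γ ∘ₗ conjY γ⁻¹) w = w
  rw [← conjY_mul, mul_inv_cancel, conjY_one, LinearMap.id_apply]

omit [CompleteSpace 𝔸] in
/-- a scalar cut-off commutes with `R(γ)`, applied (p38's `intw_cutMulY`). [cite: Balaban1985BackgroundPropagators, (3.28) p.395, (3.87) p.409, bookkeeping] -/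
theorem cutMulY_conjY_apply {X : Type} [Fintype X] (γ : X → 𝔸ˣ) (f : X → ℝ) (w : X → 𝔸) :
    cutMulY f (conjY γ w) = conjY γ (cutMulY f w) :=
  (intw_cutMulY γ f).apply w

omit [CompleteSpace 𝔸] in
/-- `R(γ)·M_f·R(γ)⁻¹ = M_f`, applied. [cite: Balaban1985BackgroundPropagators, (3.28) p.395, bookkeeping] -/
theorem conjY_cutMulY_conjY_inv_apply {X : Type} [Fintype X] (γ : X → 𝔸ˣ) (f : X → ℝ) (w : X → 𝔸) :
    conjY γ (cutMulY f (conjY γ⁻¹ w)) = cutMulY f w := by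
  rw [cutMulY_conjY_apply, conjY_conjY_inv_apply]

omit [CompleteSpace 𝔸] in
/-- `R(γ)·M_f·M_f·R(γ)⁻¹ = M_f·M_f`, applied. [cite: Balaban1985BackgroundPropagators, (3.28) p.395, bookkeeping] -/
theorem conjY_cutMulY_cutMulY_conjY_inv_apply {X : Type} [Fintype X] (γ : X → 𝔸ˣ) (f : X → ℝ) (w : X → 𝔸) :
    conjY γ (cutMulY f (cutMulY f (conjY γ⁻¹ w))) = cutMulY f (cutMulY f w) := by
  rw [cutMulY_conjY_apply, cutMulY_conjY_apply, conjY_conjY_inv_apply]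

omit [CompleteSpace 𝔸] in
/-- two cut-offs compose to the product cut-off, applied. [cite: Balaban1985BackgroundPropagators, (3.87) p.409, bookkeeping] -/
theorem cutMulY_cutMulY_apply {X : Type} (f f' : X → ℝ) (w : X → 𝔸) : cutMulY f (cutMulY f' w) = cutMulY (fun x => f x * f' x) w := by
  show (cutMulY f * cutMulY f' : Module.End ℂ (X → 𝔸)) w = _
  rw [cutMulY_mul]

omit [CompleteSpace 𝔸] in
/-- the complementary cut-off: `M_{1−f} w = w − M_f w`. [cite: Balaban1985BackgroundPropagators, (3.87) p.409, bookkeeping] -/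
theorem cutMulY_one_sub_apply {X : Type} (f : X → ℝ) (w : X → 𝔸) : cutMulY (fun x => 1 - f x) w = w - cutMulY f w := by
  have h := cutMulY_sub (𝔸 := 𝔸) (fun _ : X => (1 : ℝ)) f
  rw [cutMulY_one] at h
  rw [h, LinearMap.sub_apply, Module.End.one_apply]

/-- ★★ **THE EXACT LOCAL-INVERSE IDENTITY OF THE C-JUNCTION, DEFECT IN CLOSED FORM**: for the cut letter `O_□ = M_χR(u)⁻¹G′_□(Ṽ)R(u)M_χ` (p33's `locLetterY`) and the
letter `C_□` above,
  `M_h ∘ M_χ̃ ∘ (Q′(U)O_□O_□Q′*(U)) ∘ C_□ ∘ M_h = M_h ∘ M_h + E_□`,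
from: the gauge law of `parS` ((3.32) for `Q′`, `Q′*`), `N` ⊂ common blocks, `supp h ⊂ J(N)`, `χ̃h = h`, `χ = 1` on the sites of the `N`-blocks, agreement of the averaging
transporters of `U^u` and `Ṽ` on the `N`-blocks, and `X̂(Ṽ)Ĉ(Ṽ) = 1`.  Print's identity behind (3.95) has `E_□ = 0` (its `C_□` is the compression inverse);
the defect is the record's (RULING #5) design term, G-B9-p21-01.
[cite: Balaban1985BackgroundPropagators, (3.95) p.411, p.409 l.2–5, Cor. 3.6 p.408 l.11–14, (3.32)–(3.33) pp.395–396; Balaban1984PropagatorsII, (2.79)–(2.82) p.237] -/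
theorem cutMulY_XY_locLetterY_cinvLocLetterY {parS : SiteParY 𝔸 i} (hS : IsGaugeLawS i parS) (g : GaugeY 𝔸 i) (U V : CfgY 𝔸 i)
    (χ : SiteY i → ℝ) (h χt : BlkY i → ℝ) (N : Finset (BlkCubeY i q))
    (hN : ∀ s ∈ N, s.1 ∈ bset i.D.toDomains)
    (hh : ∀ t, h t ≠ 0 → ∃ s ∈ N, s.1 = t.1)
    (hχt : ∀ t, χt t * h t = h t)
    (hχ : ∀ z, B6Geom246MultiLevelBoxL0.blkOf (cubeFamY i q).toDomains z ∈ N → χ z = 1)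
    (hagree : ∀ s ∈ N, ∀ z, B6Geom246MultiLevelBoxL0.blkOf (cubeFamY i q).toDomains z = s →
      parS (gaugeY i g U) (blkCornerCubeY i q s) z = parS V (blkCornerCubeY i q s) z)
    (hunit : IsUnit (XCubeY i q parS V)) :
    cutMulY h ∘ₗ cutMulY χt ∘ₗ XY i parS (fun _ => locLetterY i q parS g χ V) U ∘ₗ cinvLocLetterY i q parS g V N ∘ₗ cutMulY h =
      cutMulY h ∘ₗ cutMulY h + cinvLocDefectY i q parS g χ V N h := by
  -- (3.32): `Q′(U) = R_b(u)⁻¹Q′(U^u)R(u)`, `Q′*(U) = R(u)⁻¹Q′*(U^u)R_b(u)`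
  have eQp : ∀ w, QpY i parS U w = conjY (gBlkY i g)⁻¹ (QpY i parS (gaugeY i g U) (conjY (gSiteY i g) w)) := fun w => by
    rw [(QpY_cov g U hS).apply w, conjY_inv_conjY_apply]
  have eQps : ∀ w, QpsY i parS U w = conjY (gSiteY i g)⁻¹ (QpsY i parS (gaugeY i g U) (conjY (gBlkY i g) w)) := fun w => by
    rw [(QpsY_cov g U hS).apply w, conjY_inv_conjY_apply]
  -- `M_h M_χ̃ = M_h`
  have eHt : ∀ w : BlkY i → 𝔸, cutMulY h (cutMulY χt w) = cutMulY h w := fun w => by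
    rw [cutMulY_cutMulY_apply]
    exact congrArg (fun f => cutMulY (𝔸 := 𝔸) f w) (funext fun t => by rw [mul_comm]; exact hχt t)
  -- `X̂Ĉ = 1`
  have eXC : ∀ w, XCubeY i q parS V (XinvCubeY i q parS V w) = w := fun w => by
    show (XCubeY i q parS V * XinvCubeY i q parS V) w = w
    rw [XCubeY_mul_XinvCubeY i q hunit, Module.End.one_apply]
  refine LinearMap.ext fun v => ?_
  simp only [XY, cinvLocLetterY, cinvLocDefectY, cinvDefectCoreY, locLetterY_def, LinearMap.comp_apply, Module.End.mul_apply,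
    LinearMap.add_apply, LinearMap.neg_apply]
  -- transport the member's `Q′`, `Q′*` to the gauge `u` and cancel the inner `R(u)R(u)⁻¹`
  rw [eQps, eQp]
  simp only [conjY_cutMulY_conjY_inv_apply, conjY_cutMulY_cutMulY_conjY_inv_apply, conjY_gBlkY_cubeToBlkY, eHt]
  rw [cutMulY_conjY_apply (gBlkY i g)⁻¹ h]
  -- the two row identities
  rw [cutMulY_QpY_cutMulY_eq i q parS (gaugeY i g U) V χ h N hh hχ hagree,
    cutMulY_QpsY_cubeToBlkY_eq i q parS (gaugeY i g U) V χ N hN hχ hagree]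
  -- `G′M_χ²G′ = G′² − G′(1 − M_χ²)G′`
  rw [show ∀ w : SiteY i → 𝔸, cutMulY χ (cutMulY χ w) = w - cutMulY (fun z => 1 - χ z * χ z) w from fun w => by
      rw [cutMulY_one_sub_apply, cutMulY_cutMulY_apply, sub_sub_cancel]]
  simp only [map_sub]
  -- `Q′_□G′_□²Q′_□* = X̂`, `X̂·1_N·Ĉ = 1 − X̂(1 − 1_N)Ĉ`
  have eX : ∀ w, QpCubeY i q parS V (GpCubeY i q parS V (GpCubeY i q parS V (QpsCubeY i q parS V w))) = XCubeY i q parS V w :=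
    fun w => rfl
  have eXP : ∀ w, XCubeY i q parS V (cutMulY (cubeBlkInd i q N) (XinvCubeY i q parS V w)) =
      w - XCubeY i q parS V (cutMulY (fun s => 1 - cubeBlkInd i q N s) (XinvCubeY i q parS V w)) := fun w => by
    rw [cutMulY_one_sub_apply, map_sub, eXC, sub_sub_cancel]
  rw [eX, eXP]
  simp only [map_sub]
  -- the exact part: `R_b⁻¹ M_h J R_c 1_N J⋆ M_h = M_h M_h`
  rw [← conjY_gBlkY_cubeToBlkY, cutMulY_conjY_apply (gBlkY i g) h, conjY_inv_conjY_apply,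
    cutMulY_cubeToBlkY_ind_blkToCubeY i q h N hh]
  -- bookkeeping of signs
  simp only [map_add]
  abel

/-- ★★ **M5.6's BINDER `hdef` DISCHARGED** for `Oc □ := fun _ => locLetterY i □ parS u χ Ṽ`, `Cl □ := (cinvLocLetterY …).restrictScalars ℝ`,
`E □ := (cinvLocDefectY …).restrictScalars ℝ` — the identity of `cutMulY_XY_locLetterY_cinvLocLetterY` in the EXACT SHAPE of
`B9Thm39CinvAtCoverLargeDefect.cinv_cover_large_defect`'s hypothesis (products in `Module.End ℝ (BlkY i → 𝔸)`).
[cite: Balaban1985BackgroundPropagators, (3.95) p.411, p.409 l.2–5; Balaban1984PropagatorsII, (2.82) p.237] -/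
theorem hdef_cinvLocLetterY {parS : SiteParY 𝔸 i} (hS : IsGaugeLawS i parS) (g : GaugeY 𝔸 i) (U V : CfgY 𝔸 i)
    (χ : SiteY i → ℝ) (h χt : BlkY i → ℝ) (N : Finset (BlkCubeY i q))
    (hN : ∀ s ∈ N, s.1 ∈ bset i.D.toDomains)
    (hh : ∀ t, h t ≠ 0 → ∃ s ∈ N, s.1 = t.1)
    (hχt : ∀ t, χt t * h t = h t)
    (hχ : ∀ z, B6Geom246MultiLevelBoxL0.blkOf (cubeFamY i q).toDomains z ∈ N → χ z = 1)
    (hagree : ∀ s ∈ N, ∀ z, B6Geom246MultiLevelBoxL0.blkOf (cubeFamY i q).toDomains z = s →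
      parS (gaugeY i g U) (blkCornerCubeY i q s) z = parS V (blkCornerCubeY i q s) z)
    (hunit : IsUnit (XCubeY i q parS V)) :
    (cutMulY (𝔸 := 𝔸) h).restrictScalars ℝ *
          ((cutMulY (𝔸 := 𝔸) χt).restrictScalars ℝ * (XY i parS (fun _ => locLetterY i q parS g χ V) U).restrictScalars ℝ) *
        (cinvLocLetterY i q parS g V N).restrictScalars ℝ * (cutMulY (𝔸 := 𝔸) h).restrictScalars ℝ =
      (cutMulY (𝔸 := 𝔸) h).restrictScalars ℝ * (cutMulY (𝔸 := 𝔸) h).restrictScalars ℝ + (cinvLocDefectY i q parS g χ V N h).restrictScalars ℝ := by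
  refine LinearMap.ext fun v => ?_
  have e := LinearMap.congr_fun (cutMulY_XY_locLetterY_cinvLocLetterY i q hS g U V χ h χt N hN hh hχt hχ hagree hunit) v
  simp only [LinearMap.comp_apply, LinearMap.add_apply] at e
  simpa only [Module.End.mul_apply, LinearMap.restrictScalars_apply, LinearMap.add_apply] using e

end Letter

/-! ## §4 The transporter agreement from def-Y's agreement predicate -/

section Agree

variable (i : KIdx d ℓ hd hL b₀ b₁) (q : ↥(cubes (toKT i).D.toDomains))

/-- ★ **THE TRANSPORTER AGREEMENT `hagree` FROM def-Y's `AgreeNearY`**: if `U′` and `Ṽ` agree in def-Y's sense on a site set `D` meeting every block of `N` (common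
blocks), then at a LOCAL transporter letter (`ParLocalY`, ✓ for `parSY`, `parSymY`) the averaging transporters of `U′` and `Ṽ` agree on the `N`-blocks — the agreement
clause of def-Y's predicate covers the taxi runs `c(z) ⇄ w` of every averaging pair `(z, w)`, i.e. of every `w` in the block of `z`.
[cite: Balaban1985BackgroundPropagators, (3.19) p.393, (3.24) p.394, p.410 l.14–15 («G′_□ depends on U restricted to Ω₀(□) ⊂ □̃⁵»)] -/
theorem parS_agree_of_agreeNearY {parS : SiteParY 𝔸 i} (hpar : ParLocalY i parS) {D : Finset (SiteY i)} {U' V : CfgY 𝔸 i}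
    (hUV : AgreeNearY i D U' V) (N : Finset (BlkCubeY i q)) (hN : ∀ s ∈ N, s.1 ∈ bset i.D.toDomains)
    (hD : ∀ s ∈ N, ∃ z ∈ D, B6Geom246MultiLevelBoxL0.blkOf (cubeFamY i q).toDomains z = s) :
    ∀ s ∈ N, ∀ w, B6Geom246MultiLevelBoxL0.blkOf (cubeFamY i q).toDomains w = s →
      parS U' (blkCornerCubeY i q s) w = parS V (blkCornerCubeY i q s) w := by
  intro s hs w hw
  obtain ⟨z, hzD, hz⟩ := hD s hs
  -- `s` is common: the member block `t` of `z` has the pair of `s`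
  have hts : (blkOf i.D.toDomains z).1 = s.1 := by
    rw [← hz]; exact blkOf_val_eq_of_mem i q (hz.symm ▸ hN s hs)
  -- `w` lies in the member block of `z`, so `(z, w)` is an averaging pair of the member
  have hwt : blkOf i.D.toDomains w = blkOf i.D.toDomains z := (blkOf_eq_iff_of_val_eq i q hts w).2 hw
  have hℓ : 1 ≤ ℓ := by have := hL.2; omega
  have hne : avgCoeffY i z w ≠ 0 := by
    rw [avgCoeffY_eq_ite, if_pos hwt]
    exact (levC_pos d ℓ (aPrinted_pos hℓ _ ((toKT i).D.one_le_lev z.1))).ne'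
  have hrun := (hUV.2 z hzD w hne).2
  rw [cornerY_levY_eq, blkCornerY_eq_of_val_eq i q hts] at hrun
  exact hpar hrun

end Agree

end Literature.MathematicalPhysics.QuantumFieldTheory.Balaban1983to89.B9Cor36CinvCubeLocLetter

end
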